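import Summits.CriticalPhenomena.PercolationContinuityZ3.Theorems.Transplant.PlanarSkeletonSign1
import Summits.CriticalPhenomena.PercolationContinuityZ3.Theorems.Transplant.PlanarSkeletonSignMinimal
import Summits.CriticalPhenomena.PercolationContinuityZ3.Theorems.Transplant.StatementBoxProdZ2
import Literature.Probability.Percolation.SiteConnectionTools
import HarnessLib

/-!
# THE SIDE-ON PRODUCT THEOREM: a ONE-dimensional reflectable skeleton on each factor makes `X □ Y` a customer of the D″ v2 node
# (`PlanarSkeletonSign (X □ Y)`), with Φ2 at every `p < 1` when `X` is planar-lattice-like and `Y` is line-like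

builds on p205010 (kernel theorem, internal audit signed; external expert review pending) — nothing in this file uses p205010 (the near-one
gluing enters the intended PROOF of the D″ nodes, not these reductions).
Lane `prim-bschramm`, seat `prim-bschramm-p4` (gen 8; PART C3 = general transitive `p_c < 1`, METHOD = abstract closing argument: INPUT(G) as weak as
possible); helper file (`--supports stmt-CriticalPhenomena-4575 --as helper`).  Memo: `HOME/bschramm/P4-GENERAL.md` §21.

THE POINT.  p2-g7's class-map correction for the stacked triangular lattice (`StackedTriangularSign`, p249331; postcont-2 E175 (ii)) reads the
D″ v2 interface SIDE-ON: skeleton = (ONE in-layer coordinate, the stacking coordinate).  This file isolates what that uses: NOTHING about the layer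
but a single integer height `ψ` that is sup-1-Lipschitz along edges, has outward unit steps, translating frames with finitely many types, connected
strips around base vertices, and — the only symmetry — at each base vertex ONE automorphism fixing it and REVERSING `ψ − ψ t` (`LineSkeletonNeg`).
Two such structures, one on each factor, assemble to a `PlanarSkeletonSign` on the box product (`LineSkeletonNeg.prod`): `φ = (ψ_X, ψ_Y)`, the
central inversion is `ρ_X × ρ_Y`, the axis flip is `id × ρ_Y`, frames and steps are componentwise, cylinders are products of strips.  The line `ℤ`
itself carries one (`LineSkeletonNeg.int`), so **every `X` with a `LineSkeletonNeg` yields the D″ customer `X □ ℤ`** — the honeycomb, kagome and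
triangular lattices `× ℤ` (files `HoneycombZSign`, `KagomeZSign`; `StackedTriangularSign`), every cubic-type lattice, `H₃(ℤ) × ℤ` over `(x, t)`, … .
Φ2 (cylinders subcritical) is discharged at EVERY `p < 1` when `X` carries a second, TRANSVERSE 1-Lipschitz coordinate `η` with bounded level sets
inside `ψ`-strips (`LineSkeletonNeg.Transverse`: `X` is "planar-lattice-like") and the strips of `Y` are finite (`Y` is "line-like"): the windows
`{|η − η t| ≤ 4(k+1)} × strip_Y` of a cylinder have pairwise disjoint edge boundaries of bounded size (`SameP.theta_eq_zero_of_bounded_cutsets`, p207782).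
* §1 `LineSkeletonNeg G` (fields `ψ, lip, types, frame, neg, Δ, degree_le, step, strip_connected`), `strip`, `reachable_of_mem_strip` (connectedness of `G` itself follows, cf. `PlanarSkeletonNeg.graph_connected` for the products below);
* §2 **`LineSkeletonNeg.prod Ψ Ψ' : PlanarSkeletonSign (X □ Y)`**, `prod_φ`, `prod_types`, `mem_prodCyl_iff` (cylinder = strip × strip);
* §3 **`LineSkeletonNeg.int : LineSkeletonNeg (zdGraph 1)`** (`ψ = w 0`, one type `{0}`, `neg = −id`), `int_strip_finite`;
* file II (`LineSkeletonSignCyl`): §4 `LineSkeletonNeg.Transverse` and `prod_cylSubcritical` (Φ2 for `Ψ.prod Ψ'` at every `p < 1`), §5 the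
  conditional theorems `prod_criticalContinuity_of_signNode(₁) : SamePDropOfSkeletonSign(₁) → ∀ v, θ_{X □ Y}(v, p_c) = 0`, §6 `X □ ℤ`.
[cite: KozmaNitzan2024, §1 p. 2 (approach 1); §4 p. 16 (Lemma 8: the lattice symmetries)] [cite: BenjaminiSchramm1996, Conj. 4]
[cite: GrimmettPercolation1999, §1.4 (p_c = 1 in one dimension); §1.6 p. 16 (automorphism invariance)]
-/

noncomputable section

namespace Summit.CriticalPhenomena.PercolationContinuityZ3.Theorems.Transplant

open MeasureTheory Literature.Probability.Percolation Literature.Probability.LatticeModels SimpleGraph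
open Literature.Barriers.CriticalPhenomena (countable_of_connected_of_locallyFinite)
open scoped Classical

/-! ## §1 The one-dimensional reflectable skeleton -/

/-- **One-dimensional skeleton with the central inversion** (the side-on interface): an integer height `ψ : V → ℤ`, 1-Lipschitz along edges,
finitely many base vertices, `ψ`-translating frames, at each base vertex ONE automorphism fixing it and reversing `ψ − ψ t`, (μ) a degree
bound, (ι) outward unit steps, (κ) connected induced strips `{|ψ − ψ t| ≤ ℓ}` (`ℓ ≥ 1`) at base vertices.  Two of them give a
`PlanarSkeletonSign` on the box product (`LineSkeletonNeg.prod`). [cite: KozmaNitzan2024, §4 p. 16 (Lemma 8: the lattice symmetries)] -/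
structure LineSkeletonNeg {V : Type} (G : SimpleGraph V) [G.LocallyFinite] where
  /-- the height `ψ : V → ℤ` -/
  ψ : V → ℤ
  /-- `ψ` is 1-Lipschitz along edges -/
  lip : ∀ ⦃u v : V⦄, G.Adj u v → |ψ u - ψ v| ≤ 1
  /-- finitely many base vertices (one per frame type) -/
  types : Finset V
  /-- FRAMES: every vertex is the image of a base vertex under an automorphism translating `ψ` -/
  frame : ∀ v : V, ∃ t ∈ types, ∃ α : G ≃g G, α t = v ∧ ∀ w, ψ (α w) = ψ w + (ψ v - ψ t)
  /-- THE REFLECTION: at each base vertex an automorphism fixing it and reversing the relative height -/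
  neg : ∀ t ∈ types, ∃ α : G ≃g G, α t = t ∧ ∀ w, ψ (α w) - ψ t = -(ψ w - ψ t)
  /-- (μ) a degree bound -/
  Δ : ℕ
  /-- every vertex has degree `≤ Δ` -/
  degree_le : ∀ v : V, G.degree v ≤ Δ
  /-- (ι) an up-step and a down-step at every vertex -/
  step : ∀ (v : V) (σ : ℤˣ), ∃ v' : V, G.Adj v v' ∧ ψ v' = ψ v + (σ : ℤ)
  /-- (κ) the graph induced on each strip at a base vertex, `ℓ ≥ 1`, is connected -/
  strip_connected : ∀ t ∈ types, ∀ ℓ : ℕ, 1 ≤ ℓ → (G.induce {w | |ψ w - ψ t| ≤ ℓ}).Connected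

namespace LineSkeletonNeg

variable {V : Type} {G : SimpleGraph V} [G.LocallyFinite] (Ψ : LineSkeletonNeg G)

/-- The strip of half-width `ℓ` at `t`: `{|ψ − ψ t| ≤ ℓ}`. [cite: KozmaNitzan2024, §4 p. 15 (boxes)] -/
def strip (t : V) (ℓ : ℕ) : Set V := {w | |Ψ.ψ w - Ψ.ψ t| ≤ ℓ}

/-- Membership in a strip. [folklore] -/
theorem mem_strip {t : V} {ℓ : ℕ} {w : V} : w ∈ Ψ.strip t ℓ ↔ |Ψ.ψ w - Ψ.ψ t| ≤ ℓ := Iff.rfl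

/-- The centre lies in its strips. [folklore] -/
theorem mem_strip_self (t : V) (ℓ : ℕ) : t ∈ Ψ.strip t ℓ := by
  rw [mem_strip, sub_self, abs_zero]; exact Nat.cast_nonneg ℓ

/-- Every vertex of a strip at a base vertex is joined to the centre inside `G`. [folklore] -/
theorem reachable_of_mem_strip {t : V} (ht : t ∈ Ψ.types) {ℓ : ℕ} (hℓ : 1 ≤ ℓ) {w : V} (hw : w ∈ Ψ.strip t ℓ) : G.Reachable w t := by
  have h := (Ψ.strip_connected t ht ℓ hℓ).preconnected ⟨w, hw⟩ ⟨t, Ψ.mem_strip_self t ℓ⟩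
  exact h.map (Embedding.induce _).toHom

end LineSkeletonNeg

/-! ## §2 The product skeleton -/

namespace LineSkeletonNeg

variable {V : Type} {X : SimpleGraph V} [X.LocallyFinite] (Ψ : LineSkeletonNeg X)
variable {W : Type} {Y : SimpleGraph W} [Y.LocallyFinite] (Ψ' : LineSkeletonNeg Y)

/-- The side-on skeleton map of the product: `(v, w) ↦ (ψ v, ψ' w)`. [folklore] -/
def prodφ (x : V × W) : Site 2 := ![Ψ.ψ x.1, Ψ'.ψ x.2]

/-- First coordinate of `prodφ`. [folklore] -/
@[simp] theorem prodφ_apply_zero (x : V × W) : Ψ.prodφ Ψ' x 0 = Ψ.ψ x.1 := rfl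

/-- Second coordinate of `prodφ`. [folklore] -/
@[simp] theorem prodφ_apply_one (x : V × W) : Ψ.prodφ Ψ' x 1 = Ψ'.ψ x.2 := rfl

/-- The relative skeleton coordinate lies in the box iff both factors lie in their strips. [folklore] -/
theorem prodφ_sub_mem_box_iff (x t : V × W) (ℓ : ℕ) :
    Ψ.prodφ Ψ' x - Ψ.prodφ Ψ' t ∈ box 2 ℓ ↔ x.1 ∈ Ψ.strip t.1 ℓ ∧ x.2 ∈ Ψ'.strip t.2 ℓ := by
  rw [mem_box, Fin.forall_fin_two, mem_strip, mem_strip, abs_le, abs_le]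
  simp [prodφ]

variable [(X □ Y).LocallyFinite]

/-- **THE SIDE-ON PRODUCT SKELETON**: two one-dimensional reflectable skeletons give a `PlanarSkeletonSign` on `X □ Y` — `φ = (ψ_X, ψ_Y)`,
base vertices `types_X × types_Y`, frames / central inversion / axis flip = products of the factors' automorphisms (`boxProdIso`), degree bound
`Δ_X + Δ_Y`, unit steps in each factor, cylinders = strip × strip (connected as a box product of connected induced graphs).
[cite: KozmaNitzan2024, §4 p. 16 (Lemma 8: the lattice symmetries)] [cite: BenjaminiSchramm1996, §2 (products)] -/
def prod : PlanarSkeletonSign (X □ Y) where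
  φ := Ψ.prodφ Ψ'
  lip := by
    intro u v h i
    rcases boxProd_adj.1 h with ⟨h1, h2⟩ | ⟨h1, h2⟩
    · fin_cases i
      · simpa using Ψ.lip h1
      · simp [h2]
    · fin_cases i
      · simp [h2]
      · simpa using Ψ'.lip h1
  types := Ψ.types ×ˢ Ψ'.types
  frame := by
    intro v
    obtain ⟨t, ht, α, hαt, hα⟩ := Ψ.frame v.1
    obtain ⟨u, hu, β, hβu, hβ⟩ := Ψ'.frame v.2
    refine ⟨(t, u), Finset.mk_mem_product ht hu, boxProdIso α β, ?_, fun w => ?_⟩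
    · rw [boxProdIso_apply, hαt, hβu]
    · funext i
      fin_cases i
      · simp [prodφ, hα]
      · simp [prodφ, hβ]
  neg := by
    intro tu htu
    obtain ⟨ht, hu⟩ := Finset.mem_product.1 htu
    obtain ⟨α, hαt, hα⟩ := Ψ.neg tu.1 ht
    obtain ⟨β, hβu, hβ⟩ := Ψ'.neg tu.2 hu
    refine ⟨boxProdIso α β, ?_, fun w => ?_⟩
    · rw [boxProdIso_apply, hαt, hβu]
    · funext i
      fin_cases i
      · simpa [prodφ] using hα w.1
      · simpa [prodφ] using hβ w.2
  Δ := Ψ.Δ + Ψ'.Δ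
  degree_le := fun v => by
    rw [degree_boxProd]
    exact add_le_add (Ψ.degree_le v.1) (Ψ'.degree_le v.2)
  step := by
    intro v i σ
    fin_cases i
    · obtain ⟨v', hadj, hψ⟩ := Ψ.step v.1 σ
      refine ⟨(v', v.2), boxProd_adj.2 (Or.inl ⟨hadj, rfl⟩), ?_⟩
      funext j
      fin_cases j
      · simp [prodφ, hψ]
      · simp [prodφ]
    · obtain ⟨v', hadj, hψ⟩ := Ψ'.step v.2 σ
      refine ⟨(v.1, v'), boxProd_adj.2 (Or.inr ⟨hadj, rfl⟩), ?_⟩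
      funext j
      fin_cases j
      · simp [prodφ]
      · simp [prodφ, hψ]
  cyl_connected := by
    intro tu htu ℓ hℓ
    obtain ⟨ht, hu⟩ := Finset.mem_product.1 htu
    set C : Set (V × W) := {w | Ψ.prodφ Ψ' w - Ψ.prodφ Ψ' tu ∈ box 2 ℓ} with hC
    have hmem : ∀ w, w ∈ C ↔ w.1 ∈ Ψ.strip tu.1 ℓ ∧ w.2 ∈ Ψ'.strip tu.2 ℓ := fun w => Ψ.prodφ_sub_mem_box_iff Ψ' w tu ℓ
    let f : SimpleGraph.boxProd (X.induce (Ψ.strip tu.1 ℓ)) (Y.induce (Ψ'.strip tu.2 ℓ)) →g (X □ Y).induce C :=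
      { toFun := fun ab => ⟨(ab.1.1, ab.2.1), (hmem _).2 ⟨ab.1.2, ab.2.2⟩⟩
        map_rel' := by
          rintro ⟨a, b⟩ ⟨a', b'⟩ h
          rcases boxProd_adj.1 h with ⟨h1, h2⟩ | ⟨h1, h2⟩
          · subst h2
            simp only [comap_adj, Function.Embedding.coe_subtype] at h1 ⊢
            exact boxProd_adj.2 (Or.inl ⟨h1, rfl⟩)
          · subst h2
            simp only [comap_adj, Function.Embedding.coe_subtype] at h1 ⊢
            exact boxProd_adj.2 (Or.inr ⟨h1, rfl⟩) }
    have hf : Function.Surjective f := by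
      rintro ⟨⟨a, b⟩, hab⟩
      obtain ⟨ha, hb⟩ := (hmem _).1 hab
      exact ⟨(⟨a, ha⟩, ⟨b, hb⟩), rfl⟩
    exact ((Ψ.strip_connected _ ht ℓ hℓ).boxProd (Ψ'.strip_connected _ hu ℓ hℓ)).map f hf
  flip := by
    intro tu htu
    obtain ⟨-, hu⟩ := Finset.mem_product.1 htu
    obtain ⟨β, hβu, hβ⟩ := Ψ'.neg tu.2 hu
    refine ⟨boxProdIso (RelIso.refl _) β, ?_, fun w => ?_⟩
    · rw [boxProdIso_apply, hβu]; rfl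
    · funext i
      fin_cases i
      · simp [prodφ, flipSnd]
      · simpa [prodφ, flipSnd] using hβ w.2

/-- The skeleton map of the product. [folklore] -/
@[simp] theorem prod_φ : (Ψ.prod Ψ').φ = Ψ.prodφ Ψ' := rfl

/-- The base vertices of the product. [folklore] -/
@[simp] theorem prod_types : (Ψ.prod Ψ').types = Ψ.types ×ˢ Ψ'.types := rfl

/-- The degree bound of the product. [folklore] -/
@[simp] theorem prod_Δ : (Ψ.prod Ψ').Δ = Ψ.Δ + Ψ'.Δ := rfl

/-- **The cylinders of the product are products of strips.** [folklore] -/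
theorem mem_prodCyl_iff (tu : V × W) (ℓ : ℕ) (w : V × W) :
    w ∈ (Ψ.prod Ψ').toPlanarSkeletonNeg.cyl tu ℓ ↔ w.1 ∈ Ψ.strip tu.1 ℓ ∧ w.2 ∈ Ψ'.strip tu.2 ℓ :=
  Ψ.prodφ_sub_mem_box_iff Ψ' w tu ℓ

end LineSkeletonNeg

/-! ## §3 The line `ℤ` -/

namespace LineSkeletonNeg

/-- **The line carries a one-dimensional reflectable skeleton**: `ψ = w 0`, one base vertex `0`, frames = translations (`zdShiftIso`), reflection
`= −id` (the signed permutation `(1, −1)`), degree `≤ 2`, unit steps `± e₀`, strips = the boxes `Λ_ℓ` (connected, tree `box_induce_reachable`). [folklore] -/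
def int : LineSkeletonNeg (zdGraph 1) where
  ψ := fun w => w 0
  lip := by
    intro u v h
    obtain ⟨i, hi | hi⟩ := (zdGraph_adj_iff u v).1 h
    · have : i = 0 := Subsingleton.elim _ _
      subst this; rw [hi]; simp
    · have : i = 0 := Subsingleton.elim _ _
      subst this; rw [hi]; simp
  types := {0}
  frame := fun v => ⟨0, Finset.mem_singleton_self 0, zdShiftIso v, by simp, fun w => by simp⟩
  neg := by
    intro t ht
    rw [Finset.mem_singleton] at ht
    subst ht
    refine ⟨zdSignedPermIso (1 : Equiv.Perm (Fin 1)) (fun _ => (-1 : ℤˣ)), ?_, fun w => ?_⟩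
    · rw [zdSignedPermIso_apply, Site.signedPerm_zero]
    · rw [zdSignedPermIso_apply, Site.signedPerm_apply]
      have h1 : ((1 : Equiv.Perm (Fin 1)).symm 0 : Fin 1) = 0 := Subsingleton.elim _ _
      rw [h1]
      simp
  Δ := 2
  degree_le := fun v => by simpa using degree_zdGraph_le_two_mul v
  step := by
    intro v σ
    refine ⟨v + Pi.single 0 (σ : ℤ), ?_, by simp⟩
    rw [zdGraph_adj_iff]
    rcases Int.units_eq_one_or σ with h | h
    · exact ⟨0, Or.inl (by rw [h, Units.val_one])⟩
    · refine ⟨0, Or.inr ?_⟩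
      rw [h, add_assoc, ← Pi.single_add]
      simp
  strip_connected := by
    intro t ht ℓ _
    rw [Finset.mem_singleton] at ht
    subst ht
    have e : {w : Site 1 | |w 0 - (0 : Site 1) 0| ≤ (ℓ : ℤ)} = (↑(box 1 ℓ) : Set (Site 1)) := by
      ext w
      simp only [Set.mem_setOf_eq, Pi.zero_apply, sub_zero, Finset.mem_coe, mem_box, abs_le]
      constructor
      · intro h i
        have : i = 0 := Subsingleton.elim _ _
        subst this; exact h
      · intro h; exact h 0
    rw [e]
    haveI : Nonempty (↑(box 1 ℓ) : Set (Site 1)) := ⟨⟨0, Finset.mem_coe.2 (zero_mem_box 1 ℓ)⟩⟩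
    exact Connected.mk fun a b => box_induce_reachable ℓ (Finset.mem_coe.1 a.2) (Finset.mem_coe.1 b.2)

/-- The height of `int` is the coordinate. [folklore] -/
@[simp] theorem int_ψ (w : Site 1) : int.ψ w = w 0 := rfl

/-- The base vertex of `int` is `0`. [folklore] -/
@[simp] theorem int_types : int.types = {0} := rfl

/-- The degree bound of `int` is `2`. [folklore] -/
@[simp] theorem int_Δ : int.Δ = 2 := rfl

/-- **The strips of the line are finite** (they are the boxes `Λ_ℓ + t`). [folklore] -/
theorem int_strip_finite (t : Site 1) (ℓ : ℕ) : (int.strip t ℓ).Finite := by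
  have hsub : int.strip t ℓ ⊆ (fun k : Finset.Icc (t 0 - ℓ) (t 0 + ℓ) => (fun _ : Fin 1 => (k : ℤ))) '' Set.univ := by
    intro w hw
    rw [mem_strip, int_ψ, int_ψ, abs_le] at hw
    refine ⟨⟨w 0, Finset.mem_Icc.2 ⟨by linarith [hw.1], by linarith [hw.2]⟩⟩, Set.mem_univ _, ?_⟩
    funext i
    have : i = 0 := Subsingleton.elim _ _
    subst this; rfl
  exact (Set.finite_univ.image _).subset hsub

end LineSkeletonNeg

end Summit.CriticalPhenomena.PercolationContinuityZ3.Theorems.Transplant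

end
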